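import Summits.KontsevichZagierPeriods.KontsevichZagierPeriods.Theorems.HurwitzMicroSectorsNormalFormPrincipleDimOneRatMultiple
import Summits.KontsevichZagierPeriods.KontsevichZagierPeriods.Theorems.AbelContractionRealHyperellipticSectorPortRatVanishing

/-!
# Route AbelContraction — `RealHyperellipticSector` (crux stmt-KontsevichZagierPeriods-12475):
# the dimension-certified port, layer 8 — box integrands with real algebraic coefficients

Helper file of the line `Lines/birth.lean` (stub `stub_bakerAlg`, `--supports` the crux): the port
of `Theorems/HurwitzMicroSectorsNormalFormPrincipleDimOneRatMultiple.lean` (namespace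
`…NormalFormPrinciple.PiBox.Dlog`) INTO THE BUDGET `KZ.relationsLE 1`: `nfD_of_algK` (registered
sub-goal) — every box representation `[(0,1), P/Q]` of dimension one with a `K`-rational integrand
(`K = algebraicClosure ℚ ℝ`, the real algebraic numbers) without poles on `[0,1]` is a mixed normal
form `[pt, r] + Σ Λ(uⱼ, cⱼ) + Σ T(t_l, d_l)` in `FormalRep ⧸ relationsLE 1` (`Port.Dlog.nfD_of_dvd`,
the divisibility bookkeeping `exists_dvd_map_of_ne_zero` being reused from the original). This is
the form in which the genus-`0` (Baker) sector of the crux meets the port: an `algArcs` element is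
reduced to finitely many such unit-slab representations by moves of dimension `1`.

Sources: M. Kontsevich, D. Zagier, *Periods* (2001), §1.2 [KontsevichZagier2001]; A. Baker,
*Transcendental Number Theory* (1975), Thm. 2.1 (through `nfD_eq_zero_of_eval_eq_zero`).
No definitions are introduced.
-/

noncomputable section

open MeasureTheory Set
open scoped Polynomial
open Literature.NumberTheory.Transcendental Literature.NumberTheory.Transcendental.KZ

namespace Summit.KontsevichZagierPeriods.AbelContraction.RealHyperellipticSector.Port

namespace Dlog

open Summit.KontsevichZagierPeriods.HurwitzMicroSectors.NormalFormPrinciple.PiBox.Dlog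
  (exists_dvd_map_of_ne_zero)

/-- **A box representation of dimension one with a `K`-rational integrand is a mixed normal form**
in `FormalRep ⧸ relationsLE 1` (inside the budget `relationsLE 1`; registered sub-goal of crux
stmt-KontsevichZagierPeriods-12475, port of `PiBox.Dlog.nfD_of_algK`). If `N = [(0,1), P/Q]` with
`P, Q ∈ K[X]` (`K` the real algebraic numbers) and `Q` without zeros on `[0,1]`, then the class of
`N` modulo the TRUNCATED Kontsevich–Zagier relations `relationsLE 1` is a mixed normal form
`[pt, r] + Σ Λ(uⱼ, cⱼ) + Σ T(t_l, d_l)` (`Port.Dlog.nfD_of_dvd`, the divisibility bookkeeping being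
supplied by `exists_dvd_map_of_ne_zero`). [cite: KontsevichZagier2001, §1.2] -/
theorem nfD_of_algK : ∀ {RA : ℝ → ℝ → ℝ → KZ.IntegralRep 1} {ZA : ℝ → KZ.IntegralRep 0}
    {RG : ℝ → ℝ → KZ.IntegralRep 1},
    (∀ a b c, IsAlgebraic ℚ a → IsAlgebraic ℚ b → IsAlgebraic ℚ c → 0 < a →
      (RA a b c).domain = {x | x 0 ∈ Set.Ioo a b} ∧ (RA a b c).integrand = fun x => c / x 0) →
    (∀ r, IsAlgebraic ℚ r → (ZA r).domain = Set.univ ∧ (ZA r).integrand = fun _ => r) →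
    (∀ t d, IsAlgebraic ℚ t → IsAlgebraic ℚ d →
      (RG t d).domain = {x | x 0 ∈ Set.Ioo 0 t} ∧ (RG t d).integrand = fun x => d / (1 + x 0 ^ 2)) →
    ∀ (P Q : Polynomial (algebraicClosure ℚ ℝ)),
    (∀ t ∈ Set.Icc (0:ℝ) 1, (Polynomial.aeval t Q : ℝ) ≠ 0) →
    ∀ (N : KZ.IntegralRep 1), N.domain = {x | x 0 ∈ Set.Ioo (0:ℝ) 1} →
    Set.EqOn N.integrand (fun x => (Polynomial.aeval (x 0) P : ℝ) / Polynomial.aeval (x 0) Q)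
      N.domain →
    ∃ (r : ℝ) (k : ℕ) (u c : Fin k → ℝ) (k' : ℕ) (t d : Fin k' → ℝ), IsAlgebraic ℚ r ∧
      (∀ j, 1 < u j) ∧ (∀ j, IsAlgebraic ℚ (u j)) ∧ (∀ j, IsAlgebraic ℚ (c j)) ∧ (∀ l, 0 ≤ t l) ∧
      (∀ l, IsAlgebraic ℚ (t l)) ∧ (∀ l, IsAlgebraic ℚ (d l)) ∧
      QuotientAddGroup.mk' (KZ.relationsLE 1) (KZ.of N) =
        QuotientAddGroup.mk' (KZ.relationsLE 1) (KZ.of (ZA r)) +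
          ∑ j, QuotientAddGroup.mk' (KZ.relationsLE 1) (KZ.of (RA 1 (u j) (c j))) +
          ∑ l, QuotientAddGroup.mk' (KZ.relationsLE 1) (KZ.of (RG (t l) (d l))) := by
  intro RA ZA RG hR hZ hRG P Q hQ N hNd hNi
  have hQ0 : Q ≠ 0 := fun h => hQ 0 ⟨le_rfl, zero_le_one⟩ (by rw [h, map_zero])
  obtain ⟨q₀, hq₀, hdvd⟩ := exists_dvd_map_of_ne_zero Q hQ0
  exact nfD_of_dvd hR hZ hRG hq₀ _ P Q N hQ0 le_rfl hdvd hQ hNd hNi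

end Dlog

end Summit.KontsevichZagierPeriods.AbelContraction.RealHyperellipticSector.Port

end
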